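import Summits.CriticalPhenomena.SAWScalingLimit.Theorems.SAWDevelopingMapHexConjectureReflexFluxLine
import Literature.Probability.RandomPlanarGeometry.HexDomainSingleton
import Literature.Probability.LatticeModels.TriangularLatticeProofs

/-!
# Reflex-wedge geometry: coordinates of the truncated `300°` wedge `W_N`

Support file for the crux `HexConjecture` (stmt-CriticalPhenomena-0808), line
`marginal-reflex-wedge-cauchy-kernel`, stub `stub_reflexWedgeGeometry` (the GEOMETRY of the truncated
reflex wedge `W_N = {v : ‖c_v‖ < N, arg c_v ∉ [0, π/3]}` of the honeycomb lattice, objects file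
`SAWDevelopingMapHexConjectureMarginalWedgeDefs.lean`).

In the cell coordinates `v = ((a, b); t)` of `TriangularLattice.lean` (`t = 0` up-face, `t = 1` down-face)
the centre `c_v` has `2 re c_v = 2a + b + t + 1`, `im c_v = (3b + t + 1) √3/6`, and
`9 ‖c_v‖² = A² + AB + B²` with the INTEGERS `A = 3a + t + 1`, `B = 3b + t + 1` (`nine_mul_norm_center_sq`;
`norm_center_le_iff`, `norm_center_lt_iff` compare norms of centres through this integer form):
* `inSector_iff` — the closed `60°` sector `0 ≤ arg ≤ π/3` is EXACTLY the quadrant `0 ≤ a ∧ 0 ≤ b`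
  (no honeycomb vertex lies on either ray); `arg_center_neg_iff` (`arg c_v < 0 ↔ b < 0`),
  `pi_div_three_lt_arg_iff` (`π/3 < arg c_v ↔ a < 0 ∧ 0 ≤ b`); `mem_wedge_iff`, `not_mem_wedge_iff`;
* **`reflexWedge_cornerDart`** — the root dart `cornerIn → cornerOut` is a boundary dart of `W_N`
  (`cornerIn ∈ W_N` is `FluxLine.cornerIn_mem` of `SAWDevelopingMapHexConjectureReflexFluxLine.lean`);
* **`rayZeroDart_eq`**, **`raySixtyDart_eq`** — CLASSIFICATION of the ray darts: a `0°`-ray dart is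
  `((n,-1);1) → ((n,0);0)`, `n ≥ 1`, a `60°`-ray dart is `((-1,n);1) → ((0,n);0)`, `n ≥ 0`;
  `hexCenter_sub_rayZero`, `hexCenter_sub_raySixty` — their increments `i/√3`, `e^{-iπ/6}/√3`.

This file deliberately does NOT import `HexConjecture/Negative/NonVacuity.lean` (whose integer form `qf` it
re-derives in coordinates): that module no longer builds after `Theses.SAWDefectDecoherence` dropped its copy of
`HexConjecture` (rev 17), which also made the first version `…ReflexWedgeGeometryA.lean` (p90497) unbuildable;
the present series (`…Coord`, `…B`, `…C`, `…ReflexWedgeGeometry`) supersedes it. Folklore lattice arithmetic; no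
named fact is used.
-/

open scoped BigOperators Classical
open Literature.Probability.LatticeModels Literature.Probability.RandomPlanarGeometry
  Literature.Probability.RandomPlanarGeometry.SAW

namespace Summit.CriticalPhenomena.SAWScalingLimit.Theorems.HexConjecture.MarginalWedge.ReflexGeometry

/-! ### Centres in integer coordinates -/

/-- `2 re c_v = 2a + b + t + 1` for the face `((a, b); t)`. [folklore] -/
theorem two_mul_re_center (a b : ℤ) (t : Fin 2) :
    2 * (hexCenter (((![a, b] : Site 2), t) : HexVertex)).re = 2 * a + b + (((t : ℕ) : ℝ)) + 1 := by
  simp [hexCenter, triEmbed, triZeta_re, triZeta_im]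
  ring

/-- `im c_v = (3b + t + 1) √3/6` for the face `((a, b); t)`. [folklore] -/
theorem im_center_eq (a b : ℤ) (t : Fin 2) :
    (hexCenter (((![a, b] : Site 2), t) : HexVertex)).im = (3 * b + (((t : ℕ) : ℝ)) + 1) * (Real.sqrt 3 / 6) := by
  simp [hexCenter, triEmbed, triZeta_re, triZeta_im]
  ring

/-- **`9 ‖c_v‖² = A² + AB + B²`** with `A = 3a + t + 1`, `B = 3b + t + 1`. [folklore] -/
theorem nine_mul_norm_center_sq (a b : ℤ) (t : Fin 2) :
    9 * ‖hexCenter (((![a, b] : Site 2), t) : HexVertex)‖ ^ 2 =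
      (((3 * a + (t : ℕ) + 1) ^ 2 + (3 * a + (t : ℕ) + 1) * (3 * b + (t : ℕ) + 1) + (3 * b + (t : ℕ) + 1) ^ 2 : ℤ) : ℝ) := by
  rw [← Complex.normSq_eq_norm_sq, Complex.normSq_apply]
  have hre : (hexCenter (((![a, b] : Site 2), t) : HexVertex)).re = (2 * a + b + (((t : ℕ) : ℝ)) + 1) / 2 := by
    linarith [two_mul_re_center a b t]
  have h3 : Real.sqrt 3 * Real.sqrt 3 = 3 := Real.mul_self_sqrt (by norm_num)
  rw [hre, im_center_eq]
  push_cast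
  linear_combination ((3 * (b : ℝ) + ((t : ℕ) : ℝ) + 1) ^ 2 / 4) * h3

/-- Comparing norms of centres through the integer form. [folklore] -/
theorem norm_center_le_iff (a b a' b' : ℤ) (t t' : Fin 2) :
    ‖hexCenter (((![a, b] : Site 2), t) : HexVertex)‖ ≤ ‖hexCenter (((![a', b'] : Site 2), t') : HexVertex)‖ ↔
      (3 * a + (t : ℕ) + 1) ^ 2 + (3 * a + (t : ℕ) + 1) * (3 * b + (t : ℕ) + 1) + (3 * b + (t : ℕ) + 1) ^ 2 ≤
        (3 * a' + (t' : ℕ) + 1) ^ 2 + (3 * a' + (t' : ℕ) + 1) * (3 * b' + (t' : ℕ) + 1) + (3 * b' + (t' : ℕ) + 1) ^ 2 := by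
  rw [← pow_le_pow_iff_left₀ (norm_nonneg _) (norm_nonneg _) two_ne_zero]
  have h1 := nine_mul_norm_center_sq a b t
  have h2 := nine_mul_norm_center_sq a' b' t'
  constructor
  · intro h
    have h' : (((3 * a + (t : ℕ) + 1) ^ 2 + (3 * a + (t : ℕ) + 1) * (3 * b + (t : ℕ) + 1) + (3 * b + (t : ℕ) + 1) ^ 2 : ℤ) : ℝ) ≤
        (((3 * a' + (t' : ℕ) + 1) ^ 2 + (3 * a' + (t' : ℕ) + 1) * (3 * b' + (t' : ℕ) + 1) + (3 * b' + (t' : ℕ) + 1) ^ 2 : ℤ) : ℝ) := by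
      linarith
    exact_mod_cast h'
  · intro h
    have h' : (((3 * a + (t : ℕ) + 1) ^ 2 + (3 * a + (t : ℕ) + 1) * (3 * b + (t : ℕ) + 1) + (3 * b + (t : ℕ) + 1) ^ 2 : ℤ) : ℝ) ≤
        (((3 * a' + (t' : ℕ) + 1) ^ 2 + (3 * a' + (t' : ℕ) + 1) * (3 * b' + (t' : ℕ) + 1) + (3 * b' + (t' : ℕ) + 1) ^ 2 : ℤ) : ℝ) := by
      exact_mod_cast h
    linarith

/-- Beyond radius `N` through the integer form: `9N² ≤ A² + AB + B² → N ≤ ‖c_v‖`. [folklore] -/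
theorem le_norm_center_of_le {N : ℝ} (hN : 0 ≤ N) {a b : ℤ} {t : Fin 2}
    (h : 9 * N ^ 2 ≤ (((3 * a + (t : ℕ) + 1) ^ 2 + (3 * a + (t : ℕ) + 1) * (3 * b + (t : ℕ) + 1) + (3 * b + (t : ℕ) + 1) ^ 2 : ℤ) : ℝ)) :
    N ≤ ‖hexCenter (((![a, b] : Site 2), t) : HexVertex)‖ := by
  rw [← pow_le_pow_iff_left₀ hN (norm_nonneg _) two_ne_zero]
  linarith [nine_mul_norm_center_sq a b t]

/-! ### The sector in coordinates -/

/-- The centre of a face lies strictly above the real axis iff `b ≥ 0` (no centre is real). [folklore] -/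
theorem im_center_pos_iff (v : HexVertex) : 0 < (hexCenter v).im ↔ 0 ≤ v.1 1 := by
  obtain ⟨x, t⟩ := v
  obtain ⟨a, b, rfl⟩ : ∃ a b : ℤ, x = ![a, b] := ⟨x 0, x 1, by funext j; fin_cases j <;> rfl⟩
  simp only [Matrix.cons_val_one, Matrix.cons_val_fin_one]
  rw [im_center_eq]
  have hs : 0 < Real.sqrt 3 / 6 := by positivity
  have ht : (((t : ℕ) : ℝ)) = 0 ∨ (((t : ℕ) : ℝ)) = 1 := by fin_cases t <;> simp
  constructor
  · intro h
    have h' : 0 < 3 * (b : ℝ) + ((t : ℕ) : ℝ) + 1 := pos_of_mul_pos_left h hs.le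
    have hb : (-1 : ℝ) < b := by rcases ht with ht | ht <;> rw [ht] at h' <;> linarith
    exact_mod_cast (show (-1 : ℤ) < b by exact_mod_cast hb)
  · intro hb
    have hb' : (0 : ℝ) ≤ b := by exact_mod_cast hb
    refine mul_pos ?_ hs
    rcases ht with ht | ht <;> rw [ht] <;> linarith

/-- The centre of a face lies strictly below the real axis iff `b < 0`. [folklore] -/
theorem im_center_neg_iff (v : HexVertex) : (hexCenter v).im < 0 ↔ v.1 1 < 0 := by
  have hp := im_center_pos_iff v
  obtain ⟨x, t⟩ := v
  obtain ⟨a, b, rfl⟩ : ∃ a b : ℤ, x = ![a, b] := ⟨x 0, x 1, by funext j; fin_cases j <;> rfl⟩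
  simp only [Matrix.cons_val_one, Matrix.cons_val_fin_one] at hp ⊢
  have ht : (((t : ℕ) : ℝ)) = 0 ∨ (((t : ℕ) : ℝ)) = 1 := by fin_cases t <;> simp
  constructor
  · intro h
    by_contra hb
    have := hp.2 (not_lt.1 hb)
    linarith
  · intro hb
    rw [im_center_eq]
    have hb' : (b : ℝ) ≤ -1 := by exact_mod_cast (show b ≤ -1 by omega)
    refine mul_neg_of_neg_of_pos ?_ (by positivity)
    rcases ht with ht | ht <;> rw [ht] <;> linarith

/-- `arg c_v < 0 ↔ b < 0`. [folklore] -/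
theorem arg_center_neg_iff (v : HexVertex) : Complex.arg (hexCenter v) < 0 ↔ v.1 1 < 0 := by
  rw [Complex.arg_neg_iff, im_center_neg_iff]

/-- **The closed `60°` sector is the quadrant `a ≥ 0, b ≥ 0`** of the cell coordinates: for a face
centre `z` above the axis, `arg z ≤ π/3 ↔ cos (arg z) ≥ 1/2 ↔ 3 re² ≥ im²`, and in coordinates
`2 re z = 2a + b + t + 1`, `im z = (b + (t+1)/3) √3/2`. [folklore] -/
theorem inSector_iff (v : HexVertex) : InSector (hexCenter v) ↔ 0 ≤ v.1 0 ∧ 0 ≤ v.1 1 := by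
  have hpos := im_center_pos_iff v
  have hneg := im_center_neg_iff v
  obtain ⟨x, t⟩ := v
  obtain ⟨a, b, rfl⟩ : ∃ a b : ℤ, x = ![a, b] := ⟨x 0, x 1, by funext j; fin_cases j <;> rfl⟩
  simp only [Matrix.cons_val_zero, Matrix.cons_val_one, Matrix.cons_val_fin_one] at hpos hneg ⊢
  set z : ℂ := hexCenter (((![a, b] : Site 2), t) : HexVertex) with hz
  set τ : ℝ := (((t : ℕ) : ℝ)) with hτ
  have hτ01 : 0 ≤ τ ∧ τ ≤ 1 := by
    rcases (by fin_cases t <;> simp : (((t : ℕ) : ℝ)) = 0 ∨ (((t : ℕ) : ℝ)) = 1) with h | h <;>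
      rw [← hτ] at h <;> rw [h] <;> norm_num
  set q : ℝ := (b : ℝ) + (τ + 1) / 3 with hq
  have hre : 2 * z.re = 2 * a + b + τ + 1 := by rw [hz, two_mul_re_center]
  have him : z.im = q * (Real.sqrt 3 / 2) := by rw [hz, im_center_eq, hq]; ring
  have h3 : Real.sqrt 3 * Real.sqrt 3 = 3 := Real.mul_self_sqrt (by norm_num)
  have hI2 : z.im ^ 2 = q ^ 2 * (3 / 4) := by
    calc z.im ^ 2 = q ^ 2 * (Real.sqrt 3 * Real.sqrt 3) / 4 := by rw [him]; ring
      _ = q ^ 2 * (3 / 4) := by rw [h3]; ring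
  have hπ3 : (0 : ℝ) ≤ Real.pi / 3 := by positivity
  unfold InSector
  constructor
  · rintro ⟨h0, h1⟩
    have him0 : 0 ≤ z.im := Complex.arg_nonneg_iff.1 h0
    have hb : 0 ≤ b := by
      by_contra hb
      have := hneg.2 (not_le.1 hb)
      linarith
    have hb' : (0 : ℝ) ≤ b := by exact_mod_cast hb
    have hq0 : 0 ≤ q := by rw [hq]; linarith
    have himp : 0 < z.im := hpos.2 hb
    have hzne : z ≠ 0 := fun h => by rw [h] at himp; simp at himp
    have hcos : Real.cos (Real.pi / 3) ≤ Real.cos (Complex.arg z) :=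
      Real.cos_le_cos_of_nonneg_of_le_pi h0 (by linarith [Real.pi_pos]) h1
    rw [Real.cos_pi_div_three, Complex.cos_arg hzne] at hcos
    have hn : 0 < ‖z‖ := norm_pos_iff.2 hzne
    have h2 : ‖z‖ ≤ 2 * z.re := by
      have := (le_div_iff₀ hn).1 hcos
      linarith
    have hre0 : 0 ≤ 2 * z.re := by linarith [norm_nonneg z]
    have hsq : ‖z‖ ^ 2 ≤ (2 * z.re) ^ 2 := pow_le_pow_left₀ (norm_nonneg _) h2 2
    rw [Complex.sq_norm, Complex.normSq_apply] at hsq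
    have hq2 : q ^ 2 ≤ (2 * z.re) ^ 2 := by nlinarith [hsq, hI2]
    have hq3 : q ≤ 2 * z.re := (pow_le_pow_iff_left₀ hq0 hre0 two_ne_zero).1 hq2
    rw [hre, hq] at hq3
    refine ⟨?_, hb⟩
    have ha : (-1 : ℝ) < a := by linarith
    exact_mod_cast (show (-1 : ℤ) < a by exact_mod_cast ha)
  · rintro ⟨ha, hb⟩
    have himp : 0 < z.im := hpos.2 hb
    have hzne : z ≠ 0 := fun h => by rw [h] at himp; simp at himp
    refine ⟨Complex.arg_nonneg_iff.2 himp.le, ?_⟩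
    by_contra h1
    have h1' : Real.pi / 3 < Complex.arg z := not_le.1 h1
    have hcos : Real.cos (Complex.arg z) < Real.cos (Real.pi / 3) :=
      Real.cos_lt_cos_of_nonneg_of_le_pi hπ3 (Complex.arg_le_pi z) h1'
    rw [Real.cos_pi_div_three, Complex.cos_arg hzne] at hcos
    have hn : 0 < ‖z‖ := norm_pos_iff.2 hzne
    have h2 : 2 * z.re < ‖z‖ := by
      have := (div_lt_iff₀ hn).1 hcos
      linarith
    have ha' : (0 : ℝ) ≤ a := by exact_mod_cast ha
    have hb' : (0 : ℝ) ≤ b := by exact_mod_cast hb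
    have hq0 : 0 ≤ q := by rw [hq]; linarith
    have hre0 : 0 ≤ 2 * z.re := by rw [hre]; linarith
    have hsq : (2 * z.re) ^ 2 < ‖z‖ ^ 2 := pow_lt_pow_left₀ h2 hre0 two_ne_zero
    rw [Complex.sq_norm, Complex.normSq_apply] at hsq
    have hq2 : (2 * z.re) ^ 2 < q ^ 2 := by nlinarith [hsq, hI2]
    have hq3 : 2 * z.re < q := (pow_lt_pow_iff_left₀ hre0 hq0 two_ne_zero).1 hq2
    rw [hre, hq] at hq3
    linarith

/-- `π/3 < arg c_v ↔ a < 0 ∧ 0 ≤ b` (beyond the `60°` ray). [folklore] -/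
theorem pi_div_three_lt_arg_iff (v : HexVertex) :
    Real.pi / 3 < Complex.arg (hexCenter v) ↔ v.1 0 < 0 ∧ 0 ≤ v.1 1 := by
  have hS := inSector_iff v
  have hneg := arg_center_neg_iff v
  have hpos := im_center_pos_iff v
  unfold InSector at hS
  constructor
  · intro h
    have h0 : 0 ≤ Complex.arg (hexCenter v) := by linarith [Real.pi_pos]
    have hb : 0 ≤ v.1 1 := by
      by_contra hb
      have := hneg.2 (not_le.1 hb)
      linarith
    refine ⟨?_, hb⟩
    by_contra ha
    have := (hS.2 ⟨not_lt.1 ha, hb⟩).2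
    linarith
  · rintro ⟨ha, hb⟩
    have h0 : 0 ≤ Complex.arg (hexCenter v) := Complex.arg_nonneg_iff.2 (hpos.2 hb).le
    by_contra h
    have := (hS.1 ⟨h0, not_lt.1 h⟩).1
    omega

/-! ### Membership in `W_N` and the root dart -/

/-- **Membership in `W_N` in coordinates**: within radius `N` and not in the quadrant `a, b ≥ 0`. [folklore] -/
theorem mem_wedge_iff {Λ : Finset HexVertex} {N : ℝ} (hW : IsReflexWedgeTruncation Λ N) (v : HexVertex) :
    v ∈ Λ ↔ ‖hexCenter v‖ < N ∧ ¬ (0 ≤ v.1 0 ∧ 0 ≤ v.1 1) := by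
  rw [hW v, inSector_iff]

/-- Off `W_N` in coordinates: beyond radius `N` or in the quadrant. [folklore] -/
theorem not_mem_wedge_iff {Λ : Finset HexVertex} {N : ℝ} (hW : IsReflexWedgeTruncation Λ N) (v : HexVertex) :
    v ∉ Λ ↔ N ≤ ‖hexCenter v‖ ∨ (0 ≤ v.1 0 ∧ 0 ≤ v.1 1) := by
  rw [mem_wedge_iff hW, not_and_or, not_lt, not_not]

/-- **The root dart `cornerIn → cornerOut` is a boundary dart of `W_N`**, `N ≥ 1`: `cornerIn ∈ W_N`, `cornerOut`
lies in the closed sector, and the two are adjacent in `ℍ`. [folklore] -/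
theorem reflexWedge_cornerDart : ∀ (Λ : Finset HexVertex) (N : ℝ), 1 ≤ N → IsReflexWedgeTruncation Λ N → cornerIn ∈ Λ ∧ cornerOut ∉ Λ ∧ hexGraph.Adj cornerIn cornerOut := by
  intro Λ N hN hW
  refine ⟨FluxLine.cornerIn_mem hN hW, (not_mem_wedge_iff hW _).2 (Or.inr ?_), ?_⟩
  · simp [cornerOut]
  · have h := hexGraph_adj_e1 0 (-1)
    norm_num at h
    rw [cornerIn, cornerOut]
    exact h

/-! ### Classification of the ray darts -/

/-- **The `0°`-ray darts of `W_N`** are the vertical edges `((n,-1);1) → ((n,0);0)`, `n ≥ 1`: the inner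
vertex is below the axis, the outer one in the quadrant, and of the three honeycomb moves only the
vertical one crosses the axis. [folklore] -/
theorem rayZeroDart_eq {Λ : Finset HexVertex} {N : ℝ} (hW : IsReflexWedgeTruncation Λ N) {v w : HexVertex}
    (hw : w ∉ Λ) (hadj : hexGraph.Adj v w) (hray : IsRayZeroDart N v w) :
    ∃ n : ℕ, 1 ≤ n ∧ (v, w) = ((((![(n : ℤ), -1] : Site 2), (1 : Fin 2)) : HexVertex), (((![(n : ℤ), 0] : Site 2), (0 : Fin 2)) : HexVertex)) := by
  obtain ⟨hwN, hvarg, hne⟩ := hray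
  rw [arg_center_neg_iff] at hvarg
  rw [not_mem_wedge_iff hW, ← not_lt] at hw
  obtain ⟨x, t⟩ := v
  obtain ⟨y, t'⟩ := w
  obtain ⟨a, b, rfl⟩ : ∃ a b : ℤ, x = ![a, b] := ⟨x 0, x 1, by funext j; fin_cases j <;> rfl⟩
  obtain ⟨a', b', rfl⟩ : ∃ a' b' : ℤ, y = ![a', b'] := ⟨y 0, y 1, by funext j; fin_cases j <;> rfl⟩
  simp only [Matrix.cons_val_zero, Matrix.cons_val_one, Matrix.cons_val_fin_one] at hvarg hw
  have hw' : 0 ≤ a' ∧ 0 ≤ b' := by tauto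
  rw [hexGraph_adj_iff_coord] at hadj
  simp only [Matrix.cons_val_zero, Matrix.cons_val_one] at hadj
  have key : t = 1 ∧ t' = 0 ∧ b = -1 ∧ b' = 0 ∧ a = a' ∧ 0 ≤ a := by
    rcases hadj with ⟨ht, ht', h⟩ | ⟨ht, ht', h⟩ <;> refine ?_ <;> omega
  obtain ⟨rfl, rfl, rfl, rfl, rfl, ha⟩ := key
  have ha0 : a ≠ 0 := by
    rintro rfl
    exact hne rfl
  refine ⟨a.toNat, by omega, ?_⟩
  rw [Int.toNat_of_nonneg ha]

/-- **The `60°`-ray darts of `W_N`** are the edges `((-1,n);1) → ((0,n);0)`, `n ≥ 0` (direction `-30°`).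
[folklore] -/
theorem raySixtyDart_eq {Λ : Finset HexVertex} {N : ℝ} (hW : IsReflexWedgeTruncation Λ N) {v w : HexVertex}
    (hw : w ∉ Λ) (hadj : hexGraph.Adj v w) (hray : IsRaySixtyDart N v w) :
    ∃ n : ℕ, (v, w) = ((((![-1, (n : ℤ)] : Site 2), (1 : Fin 2)) : HexVertex), (((![0, (n : ℤ)] : Site 2), (0 : Fin 2)) : HexVertex)) := by
  obtain ⟨hwN, hvarg⟩ := hray
  rw [pi_div_three_lt_arg_iff] at hvarg
  rw [not_mem_wedge_iff hW, ← not_lt] at hw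
  obtain ⟨x, t⟩ := v
  obtain ⟨y, t'⟩ := w
  obtain ⟨a, b, rfl⟩ : ∃ a b : ℤ, x = ![a, b] := ⟨x 0, x 1, by funext j; fin_cases j <;> rfl⟩
  obtain ⟨a', b', rfl⟩ : ∃ a' b' : ℤ, y = ![a', b'] := ⟨y 0, y 1, by funext j; fin_cases j <;> rfl⟩
  simp only [Matrix.cons_val_zero, Matrix.cons_val_one, Matrix.cons_val_fin_one] at hvarg hw
  have hw' : 0 ≤ a' ∧ 0 ≤ b' := by tauto
  rw [hexGraph_adj_iff_coord] at hadj
  simp only [Matrix.cons_val_zero, Matrix.cons_val_one] at hadj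
  have key : t = 1 ∧ t' = 0 ∧ a = -1 ∧ a' = 0 ∧ b = b' ∧ 0 ≤ b := by
    rcases hadj with ⟨ht, ht', h⟩ | ⟨ht, ht', h⟩ <;> refine ?_ <;> omega
  obtain ⟨rfl, rfl, rfl, rfl, rfl, hb⟩ := key
  refine ⟨b.toNat, ?_⟩
  rw [Int.toNat_of_nonneg hb]

/-- The increment of the `n`-th `0°`-ray dart is `i/√3` (a vertical edge). [folklore] -/
theorem hexCenter_sub_rayZero (n : ℕ) :
    hexCenter (((![(n : ℤ), 0] : Site 2), (0 : Fin 2)) : HexVertex) -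
        hexCenter (((![(n : ℤ), -1] : Site 2), (1 : Fin 2)) : HexVertex) =
      ((Real.sqrt 3)⁻¹ : ℝ) * Complex.I := by
  have h3 : Real.sqrt 3 * Real.sqrt 3 = 3 := Real.mul_self_sqrt (by norm_num)
  have hs : Real.sqrt 3 ≠ 0 := by positivity
  have hinv : (Real.sqrt 3)⁻¹ = Real.sqrt 3 / 3 := by
    field_simp
    linarith [h3]
  have hre0 := two_mul_re_center (n : ℤ) 0 0
  have hre1 := two_mul_re_center (n : ℤ) (-1) 1
  apply Complex.ext
  · simp only [Complex.sub_re, Complex.mul_re, Complex.ofReal_re, Complex.I_re, Complex.ofReal_im, Complex.I_im]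
    simp only [Fin.val_zero, Fin.val_one, Nat.cast_zero, Nat.cast_one] at hre0 hre1
    push_cast at hre0 hre1 ⊢
    linarith
  · rw [Complex.sub_im, im_center_eq, im_center_eq, hinv]
    simp
    ring

/-- The increment of the `n`-th `60°`-ray dart is `e^{-iπ/6}/√3`. [folklore] -/
theorem hexCenter_sub_raySixty (n : ℕ) :
    hexCenter (((![0, (n : ℤ)] : Site 2), (0 : Fin 2)) : HexVertex) -
        hexCenter (((![-1, (n : ℤ)] : Site 2), (1 : Fin 2)) : HexVertex) =
      ((Real.sqrt 3)⁻¹ : ℝ) * Complex.exp (-(Real.pi / 6) * Complex.I) := by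
  have h3 : Real.sqrt 3 ^ 2 = 3 := Real.sq_sqrt (by norm_num)
  have h3' : Real.sqrt 3 * Real.sqrt 3 = 3 := Real.mul_self_sqrt (by norm_num)
  have hs : Real.sqrt 3 ≠ 0 := by positivity
  have hinv : (Real.sqrt 3)⁻¹ = Real.sqrt 3 / 3 := by
    field_simp
    linarith [h3']
  have hcos : Real.cos (-(Real.pi / 6)) = Real.sqrt 3 / 2 := by rw [Real.cos_neg, Real.cos_pi_div_six]
  have hsin : Real.sin (-(Real.pi / 6)) = -(1 / 2) := by rw [Real.sin_neg, Real.sin_pi_div_six]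
  have harg : (-(Real.pi / 6) * Complex.I : ℂ) = ((-(Real.pi / 6) : ℝ) : ℂ) * Complex.I := by
    push_cast; ring
  have hexp : Complex.exp (-(Real.pi / 6) * Complex.I) =
      ((Real.sqrt 3 / 2 : ℝ) : ℂ) + ((-(1 / 2) : ℝ) : ℂ) * Complex.I := by
    rw [harg, Complex.exp_mul_I, ← Complex.ofReal_cos, ← Complex.ofReal_sin, hcos, hsin]
  have hre0 := two_mul_re_center 0 (n : ℤ) 0
  have hre1 := two_mul_re_center (-1) (n : ℤ) 1
  rw [hexp]
  apply Complex.ext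
  · simp only [Complex.sub_re, Complex.mul_re, Complex.ofReal_re, Complex.I_re, Complex.ofReal_im, Complex.I_im,
      Complex.add_re, Complex.add_im, Complex.mul_im]
    simp only [Fin.val_zero, Fin.val_one, Nat.cast_zero, Nat.cast_one] at hre0 hre1
    push_cast at hre0 hre1 ⊢
    rw [hinv]
    nlinarith [h3]
  · rw [Complex.sub_im, im_center_eq, im_center_eq]
    simp [hinv]
    ring

end Summit.CriticalPhenomena.SAWScalingLimit.Theorems.HexConjecture.MarginalWedge.ReflexGeometry
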